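import Summits.SmoothPoincare4.SmoothPoincare4.Theorems.SymplecticOrigamiOrigamiFoldExistenceStubOuterCleanRecognitionChartCollar
import Summits.SmoothPoincare4.SmoothPoincare4.Theorems.SymplecticOrigamiOrigamiFoldExistenceStubOuterCleanRecognitionChartChimney

/-!
# Stub `stub_outerCleanRecognitionChart` of line `shadow-pleats` for crux `OrigamiFoldExistence` — F:
# the SIDE LEMMA (O1) as the named ingredient, and the collar data it yields (item stmt-SmoothPoincare4-7844, route SymplecticOrigami; seat c3, S4''-chart worker)

Sixth helper file towards `stub_outerCleanRecognitionChart : OuterCleanRecognitionChart`.  Files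
A–E settle the four topological clauses (the lifted chimney, via the tree's Jordan–Brouwer
side package) and the FIRST-ORDER structure of the outer fold collar of an outer-clean chart
(tube coordinates, angular straightening, monotone fibre heights: thin-collar injectivity,
one-sidedness IN THE TUBE, local surjectivity onto that side).  What first-order analysis cannot
decide is WHICH GLOBAL SIDE of the embedded outer crease `c_out = G(S(0,2))` the collar lies
on: this is the lead's SIDE LEMMA (O1) (`Cruxes/OrigamiFoldExistence/OuterClean-analysis-c3.md`
§2: the two germs born at `c_out` lie on its UNBOUNDED side; proof by the normal degree of the
regular homotopy `s ↦ G(s·)` between the two creases and Hopf's `deg Gauss = χ` for the immersed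
hole ball and for the region bounded by `c_out` — degree theory not available in Mathlib),
audited and confirmed at `k = 1` in `work/stubs/stub_outerCleanRecognition.md` §A.  Here:

* `OuterSideLemma : Prop` — (O1) over the line vocabulary, in the weakest form the reduction
  needs: for a `1`-chart pleated position of a homotopy `4`-sphere with outer-clean chart,
  there are points `u` of the open outer collar ARBITRARILY CLOSE to `S(0,2)` whose shadow
  `G u` lies in an UNBOUNDED connected subset of `ℝ⁴ ∖ c_out` (= the unbounded component);
* `CollarData` — the bundle the sheet count consumes (a good shell `h : StrShell D` with fibre
  heights `≤ 1/4`, `G` immersive and injective on the collar, the collar lifted into the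
  EXTERIOR of the chimney with the pole sign as outer sign, local surjectivity onto the
  exterior near the crease), and **`nonempty_collarData`** (registered helper):
  `OuterSideLemma` ⇒ collar data exist for every outer-clean `1`-chart pleated position of a
  homotopy `4`-sphere (thin-collar injectivity makes the shadow of the open collar a connected
  subset of `ℝ⁴ ∖ c_out`, so ONE point on the unbounded side puts all of it in the exterior;
  comparing signs in the tube identifies the outer sign with the pole sign).

Sources: the lead's `OuterClean-analysis-c3.md` §2 (O1), §3 (O2); H. Hopf, *Vektorfelder in
n-dimensionalen Mannigfaltigkeiten*, Math. Ann. 96 (1927) (curvatura integra `= χ`);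
M. W. Hirsch, *Differential Topology* (1976), Ch. 4 §5.
-/

noncomputable section

-- the prescribed namespace `Summit.<P>.<Sub>.…` duplicates `SmoothPoincare4` (P = Sub)
set_option linter.dupNamespace false

open scoped Manifold ContDiff Topology RealInnerProductSpace
open Set Function Filter Metric ContinuousMap
open Literature.Topology.FourManifolds Literature.Topology.FourManifolds.SphereHypersurfaceSides

namespace Summit.SmoothPoincare4.SmoothPoincare4.Theorems.OrigamiFoldExistence.ShadowPleats

/-! ### The named ingredient: the side lemma (O1) -/

/-- **THE OUTER SIDE LEMMA (O1)** — the one ingredient of `OuterCleanRecognitionChart` that is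
not first-order fold-collar geometry (TRUE ON PAPER: the lead's `OuterClean-analysis-c3.md` §2,
audited `work/stubs/stub_outerCleanRecognition.md` §A; NOT PROVED HERE — its proof is degree
theory: regular-homotopy invariance of the normal degree of immersed `3`-spheres in `ℝ⁴`, and
Hopf's `deg Gauss(∂W) = χ(W)` for the immersed hole ball and for the region bounded by the
embedded outer crease).  CONTENT, in the weakest form the reduction consumes: for a homotopy
`4`-sphere `M` in a `1`-chart pleated round-rim position `(ι, δ, e)` whose chart is OUTER-CLEAN
(the chart shadow `G = proj5 ∘ ι ∘ e₀` is injective on the outer fold sphere `S(0,2)`), and every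
`η > 0`, some point `u` of the open outer collar `{2 < ‖u‖ < 2 + η}` has its shadow `G u` in an
UNBOUNDED CONNECTED subset of `ℝ⁴ ∖ G(S(0,2))`, i.e. in the unbounded complementary component
of the outer crease.  (By thin-collar injectivity, `injOn_outerCollar`, the whole open collar
then casts its shadow into that component; the germ of the annulus at `S(0,2)` has the same
shadow image by the fold, so "both germs born at `c_out` lie on its unbounded side".) -/
def OuterSideLemma : Prop :=
  ∀ (M : Type) [TopologicalSpace M] [T2Space M] [SecondCountableTopology M]
    [ChartedSpace (EuclideanSpace ℝ (Fin 4)) M] [IsManifold (𝓡 4) ∞ M],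
    M ≃ₕ (Metric.sphere (0 : EuclideanSpace ℝ (Fin 5)) 1) →
    ∀ (ι : M → EuclideanSpace ℝ (Fin 5)) (δ : ℝ) (e : Fin 1 → EuclideanSpace ℝ (Fin 4) → M),
      IsPleatedPosition ι δ e → Set.InjOn (proj5 ∘ ι ∘ e 0) (Metric.sphere 0 2) →
      ∀ η : ℝ, 0 < η → ∃ u : EuclideanSpace ℝ (Fin 4), 2 < ‖u‖ ∧ ‖u‖ < 2 + η ∧
        ∃ W : Set (EuclideanSpace ℝ (Fin 4)), IsConnected W ∧ (proj5 ∘ ι ∘ e 0) u ∈ W ∧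
          Disjoint W ((proj5 ∘ ι ∘ e 0) '' Metric.sphere 0 2) ∧ ¬ Bornology.IsBounded W

/-! ### Collar data of an outer-clean chart -/

section CollarData

variable {M : Type} [TopologicalSpace M] [ChartedSpace (EuclideanSpace ℝ (Fin 4)) M]
  {ι : M → EuclideanSpace ℝ (Fin 5)} {e : Fin 1 → EuclideanSpace ℝ (Fin 4) → M}

/-- COLLAR DATA of the chart `e 0` of `ι` with tube data `D` of its lifted outer crease (explicit
data for the sheet count, not a named fact): a good shell `h` for the angular straightening on
which the fibre height stays `≤ 1/4`, with the chart shadow `G = proj5 ∘ ι ∘ e 0` immersive on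
the open outer collar and injective on the closed one, the open collar lifted into the EXTERIOR
of the chimney with POSITIVE pole-signed fibre height, and a height `t₀ > 0` up to which every
exterior tube point over the crease is the lifted shadow of a collar point. -/
structure CollarData (D : TubeData (liftedCrease ι (e 0))) where
  /-- the good shell -/
  h : StrShell (G := proj5 ∘ ι ∘ e 0) D
  /-- the fibre height is small on the shell -/
  abs_tubeT_le : ∀ u ∈ foldShell h.κ, |tubeT D u| ≤ 1 / 4
  /-- the chart shadow is immersive on the open outer collar -/
  immersive : ∀ u : EuclideanSpace ℝ (Fin 4), 2 < ‖u‖ → ‖u‖ < 2 + h.κ →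
    Injective (fderiv ℝ (proj5 ∘ ι ∘ e 0) u)
  /-- the pole sign is the outer sign: positive signed height on the open outer collar -/
  sign_pos : ∀ u : EuclideanSpace ℝ (Fin 4), 2 < ‖u‖ → ‖u‖ < 2 + h.κ → 0 < poleSign D * tubeT D u
  /-- the open outer collar is lifted into the exterior of the chimney -/
  mem_exterior : ∀ u : EuclideanSpace ℝ (Fin 4), 2 < ‖u‖ → ‖u‖ < 2 + h.κ →
    liftS4 ((proj5 ∘ ι ∘ e 0) u) ∈ exterior D
  /-- the chart shadow is injective on the closed outer collar -/
  injOn : InjOn (proj5 ∘ ι ∘ e 0) {u | 2 ≤ ‖u‖ ∧ ‖u‖ < 2 + h.κ}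
  /-- the height of local surjectivity -/
  t₀ : ℝ
  /-- it is positive -/
  t₀_pos : 0 < t₀
  /-- it is at most `1/4` -/
  t₀_le : t₀ ≤ 1 / 4
  /-- local surjectivity onto the exterior side of the tube -/
  localSurj : ∀ (x : Metric.sphere (0 : EuclideanSpace ℝ (Fin 4)) 1) (t : ℝ), 0 ≤ poleSign D * t →
    poleSign D * t ≤ t₀ → ∃ u : EuclideanSpace ℝ (Fin 4), 2 ≤ ‖u‖ ∧ ‖u‖ ≤ 2 + h.κ / 2 ∧
      liftS4 ((proj5 ∘ ι ∘ e 0) u) = D.τ (x, t • SphereHypersurfaceSides.e₀)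

variable {δ : ℝ}

/-- Off the fold spheres, on the open outer collar of width `≤ 1`, the chart shadow of a
`1`-pleat position is immersive. -/
theorem injective_fderiv_chartShadow_outer (hpos : IsPleatedPosition ι δ e) {u : EuclideanSpace ℝ (Fin 4)}
    (hu2 : 2 < ‖u‖) (hu3 : ‖u‖ < 3) : Injective (fderiv ℝ (proj5 ∘ ι ∘ e 0) u) := by
  refine injective_fderiv_chartShadow hpos ?_
  rintro (h1 | h2)
  · rw [mem_sphere_zero_iff_norm] at h1; linarith
  · rw [mem_sphere_zero_iff_norm] at h2; linarith

/-- The shadow of the open outer collar of a good shell carrying an outer sign misses the outer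
crease (thin-collar injectivity). -/
theorem disjoint_image_outerCollar {G : EuclideanSpace ℝ (Fin 4) → EuclideanSpace ℝ (Fin 4)}
    {D : TubeData (liftS4 ∘ radialSphere G 2)} (h : StrShell D) (hG : ContDiff ℝ ∞ G)
    (himm : ∀ u : EuclideanSpace ℝ (Fin 4), 2 < ‖u‖ → ‖u‖ < 2 + h.κ → Injective (fderiv ℝ G u))
    {s : ℝ} (hs : s = 1 ∨ s = -1)
    (hsign : ∀ u : EuclideanSpace ℝ (Fin 4), 2 < ‖u‖ → ‖u‖ < 2 + h.κ → 0 < s * tubeT D u) :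
    Disjoint (G '' {u | 2 < ‖u‖ ∧ ‖u‖ < 2 + h.κ}) (G '' Metric.sphere 0 2) := by
  refine Set.disjoint_left.2 ?_
  rintro _ ⟨u, hu, rfl⟩ ⟨u', hu', heq⟩
  have hu'2 := mem_sphere_zero_iff_norm.1 hu'
  have := h.injOn_outerCollar_of_sign hG himm hs hsign ⟨hu'2.symm.le, by rw [hu'2]; linarith [h.pos]⟩
    ⟨hu.1.le, hu.2⟩ heq
  rw [← this] at hu
  exact absurd hu'2 hu.1.ne'

/-- **COLLAR DATA EXIST, given the side lemma** (registered helper of file F): for every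
outer-clean `1`-chart pleated position of a homotopy `4`-sphere and tube data `D` of its lifted
outer crease.  [The good shell comes from files C–E; one collar point on the unbounded side
(O1) and connectedness of the shadow of the open collar (which misses the crease by thin-collar
injectivity) put the whole lifted collar in the exterior of the chimney; in the tube the
exterior is `{poleSign · height > 0}`, so the outer sign is the pole sign.] [folklore] -/
theorem nonempty_collarData (hO : OuterSideLemma) [T2Space M] [SecondCountableTopology M] [IsManifold (𝓡 4) ∞ M] (hM : M ≃ₕ (Metric.sphere (0 : EuclideanSpace ℝ (Fin 5)) 1)) (hpos : IsPleatedPosition ι δ e) (hclean : Set.InjOn (proj5 ∘ ι ∘ e 0) (Metric.sphere 0 2)) (D : TubeData (liftedCrease ι (e 0))) : Nonempty (CollarData D) := by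
  set G := proj5 ∘ ι ∘ e 0 with hGdef
  have hG : ContDiff ℝ ∞ G := contDiff_chartShadow hpos
  have hN : northPole ∉ range (liftedCrease ι (e 0)) := northPole_notMem_range_liftedCrease ι (e 0)
  -- a good shell of width ≤ 1 with small heights
  obtain ⟨h₁⟩ := nonempty_strShell (G := G) D hG
  obtain ⟨h, -, habs⟩ := h₁.exists_strShell_abs_tubeT_le hG
  have himm : ∀ u : EuclideanSpace ℝ (Fin 4), 2 < ‖u‖ → ‖u‖ < 2 + h.κ → Injective (fderiv ℝ G u) :=
    fun u hu1 hu2 => injective_fderiv_chartShadow_outer hpos hu1 (by linarith [h.le_one])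
  obtain ⟨s, hs, hsign⟩ := h.exists_outerSign hG himm
  -- (O1): one collar point on the unbounded side
  obtain ⟨u₀, hu₀2, hu₀κ, W, hWc, hu₀W, hWdisj, hWunb⟩ := hO M hM ι δ e hpos hclean h.κ h.pos
  have hW : liftS4 '' W ⊆ exterior D := by
    refine liftS4_image_subset_exterior D hN hWc.isPreconnected ?_ hWunb
    rw [range_liftedCrease]
    refine Set.disjoint_left.2 ?_
    rintro _ ⟨y, hy, rfl⟩ ⟨v, hv, hveq⟩
    exact Set.disjoint_left.1 hWdisj hy ⟨v, hv, liftS4_injective hveq⟩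
  -- the whole lifted open collar lies in the exterior
  set Ω : Set (EuclideanSpace ℝ (Fin 4)) := {u | 2 < ‖u‖ ∧ ‖u‖ < 2 + h.κ} with hΩ
  have hΩpre : IsPreconnected (liftS4 '' (G '' Ω)) :=
    ((isPreconnected_openShell two_pos).image G hG.continuous.continuousOn).image liftS4
      contMDiff_liftS4.continuous.continuousOn
  have hΩdisj : Disjoint (liftS4 '' (G '' Ω)) (range (liftedCrease ι (e 0))) := by
    rw [range_liftedCrease]
    refine Set.disjoint_left.2 ?_
    rintro _ ⟨y, hy, rfl⟩ ⟨v, hv, hveq⟩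
    exact Set.disjoint_left.1 (disjoint_image_outerCollar h hG himm hs hsign) hy ⟨v, hv, liftS4_injective hveq⟩
  have hext : liftS4 '' (G '' Ω) ⊆ exterior D :=
    subset_exterior_of_isPreconnected D hN hΩpre hΩdisj
      ⟨liftS4 (G u₀), mem_image_of_mem _ ⟨u₀, ⟨hu₀2, hu₀κ⟩, rfl⟩, hW ⟨G u₀, hu₀W, rfl⟩⟩
  have hmem : ∀ u : EuclideanSpace ℝ (Fin 4), 2 < ‖u‖ → ‖u‖ < 2 + h.κ → liftS4 (G u) ∈ exterior D :=
    fun u hu1 hu2 => hext ⟨G u, ⟨u, ⟨hu1, hu2⟩, rfl⟩, rfl⟩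
  -- the outer sign is the pole sign
  have hsign' : ∀ u : EuclideanSpace ℝ (Fin 4), 2 < ‖u‖ → ‖u‖ < 2 + h.κ → 0 < poleSign D * tubeT D u := by
    intro u hu1 hu2
    have hushell : u ∈ foldShell h.κ := ⟨by linarith [h.pos], hu2⟩
    obtain ⟨hτ, -⟩ := h.liftS4_apply_mem_tube_side hsign hu1 hu2
    have hex : 0 < sideσ D (liftS4 (G u)) := hmem u hu1 hu2
    rw [hτ, sideσ_tube D _ _ (by simpa using habs u hushell)] at hex
    simpa using hex
  obtain ⟨t₀, ht₀, hsurj⟩ := h.exists_height_localSurj hG himm (poleSign_eq_or D hN) hsign'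
  refine ⟨⟨h, habs, himm, hsign', hmem, h.injOn_outerCollar_of_sign hG himm (poleSign_eq_or D hN) hsign',
    min t₀ (1 / 4), lt_min ht₀ (by norm_num), min_le_right _ _, fun x t ht0 ht1 => ?_⟩⟩
  exact hsurj x t ht0 (ht1.trans (min_le_left _ _))

end CollarData

end Summit.SmoothPoincare4.SmoothPoincare4.Theorems.OrigamiFoldExistence.ShadowPleats

end
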